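import Summits.Langlands.Langlands.Theorems.ProModularOrdinaryClassical.Negative.PointsIntegral

/-!
# `ProModularOrdinaryClassical` (stmt-Langlands-12921) — Negative knowledge IV: the slope dichotomy
# is a theorem of `p`-adic analysis (Teichmüller convergence `u^{m!} → 1` on the unit sphere of `ℚ̄_p`)

From the standing disprover's `Cruxes/ProModularOrdinaryClassical/Disproof.lean` (cdisprove gen 2,
cycle 2, §7 S1). The merged lead card of the crux (`split-prime-paskunas-fibre ≈ paskunas-centre-split`)
files as its FIRST LEMMA the stub `SlopeDichotomy`: for a continuous `ℚ̄_p`-point `x` of the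
Hida-tower Hecke algebra `𝕋^S(𝒰; p)` and `v ∣ p`, either `IsSlopeZeroAt x v` (`x(U_{v,1})^{m!} → 1`)
or `x(U_{v,1})^{m!} → 0`. This file PROVES it outright (`slopeDichotomy`), together with the clean
reformulation `isSlopeZeroAt_iff_norm_eq_one` (`IsSlopeZeroAt x v ↔ ‖x(U_{v,1})‖ = 1` for continuous
`x`, rank `2`), from two inputs with no automorphic content:

* integrality of continuous points (`norm_apply_le_one_of_continuous_hida`, `PointsIntegral.lean`);
* **Teichmüller convergence on the unit sphere of `ℚ̄_p`** (`tendsto_pow_factorial_nhds_one`): for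
  `u ∈ ℚ̄_p` with `‖u‖ = 1`, `u^{m!} → 1`. Proof: (1) `exists_norm_pow_sub_one_lt_one` — some power
  `u^M`, `M ≥ 1`, lies in the open unit ball around `1`: the powers of `u` live in the unit ball of
  the finite-dimensional (`u` is algebraic) hence PROPER `ℚ_p`-subspace `ℚ_p(u)`; cover that compact
  ball by finitely many open unit balls and pigeonhole two powers into one of them (ultrametric);
  (2) the elementary ultrametric estimates `norm_one_add_pow_sub_one_le` (`‖(1+z)^i − 1‖ ≤ ‖z‖`),
  `norm_one_add_pow_sub_one_le_mul` (`‖(1+z)^q − 1‖ ≤ ‖z‖ · max(‖q‖, ‖z‖)`, via the geometric sum) and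
  `norm_one_add_pow_pow_sub_one_le` (`‖(1+z)^{q^k} − 1‖ ≤ ‖z‖ · max(‖q‖, ‖z‖)^k`), valid in any
  ultrametric normed field; (3) `M p^k ∣ m!` for `m ≥ M p^k`.

So the stub carries ZERO prover content: the content of a "Galois-ordinary ⇒ Hecke-ordinary" line is
entirely in deciding WHICH branch holds (`Disproof.lean` §7). [folklore]
-/

set_option linter.dupNamespace false

namespace Summit.Langlands.Langlands.Theorems.ProModularOrdinaryClassical.Negative

open Literature.NumberTheory.Automorphic Literature.NumberTheory.Automorphic.BigHeckeGLn
open NumberField IsDedekindDomain Filter Topology Metric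

/-! ### Elementary ultrametric estimates -/

section Ultra

variable {K : Type*} [NormedField K] [IsUltrametricDist K]

/-- `‖(1+z)^i − 1‖ ≤ ‖z‖` for `‖z‖ ≤ 1` (ultrametric). [folklore] -/
theorem norm_one_add_pow_sub_one_le {z : K} (hz : ‖z‖ ≤ 1) (i : ℕ) : ‖(1 + z) ^ i - 1‖ ≤ ‖z‖ := by
  induction i with
  | zero => simp
  | succ i ih =>
    have h1 : ‖1 + z‖ ≤ 1 :=
      (IsUltrametricDist.norm_add_le_max 1 z).trans (max_le (by simp) hz)
    have e : (1 + z) ^ (i + 1) - 1 = (1 + z) * ((1 + z) ^ i - 1) + z := by ring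
    rw [e]
    refine (IsUltrametricDist.norm_add_le_max _ _).trans (max_le ?_ le_rfl)
    rw [norm_mul]
    calc ‖1 + z‖ * ‖(1 + z) ^ i - 1‖ ≤ 1 * ‖z‖ := mul_le_mul h1 ih (norm_nonneg _) zero_le_one
      _ = ‖z‖ := one_mul _

/-- `‖(∑_{i<n} (1+z)^i) − n‖ ≤ ‖z‖` for `‖z‖ ≤ 1`. [folklore] -/
theorem norm_geom_sum_sub_natCast_le {z : K} (hz : ‖z‖ ≤ 1) (n : ℕ) :
    ‖(∑ i ∈ Finset.range n, (1 + z) ^ i) - n‖ ≤ ‖z‖ := by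
  induction n with
  | zero => simp
  | succ n ih =>
    have e : (∑ i ∈ Finset.range (n + 1), (1 + z) ^ i) - ((n + 1 : ℕ) : K) =
        ((∑ i ∈ Finset.range n, (1 + z) ^ i) - n) + ((1 + z) ^ n - 1) := by
      rw [Finset.sum_range_succ]; push_cast; ring
    rw [e]
    exact (IsUltrametricDist.norm_add_le_max _ _).trans (max_le ih (norm_one_add_pow_sub_one_le hz n))

/-- `‖(1+z)^q − 1‖ ≤ ‖z‖ · max(‖q‖, ‖z‖)` for `‖z‖ ≤ 1`: `(1+z)^q − 1 = z · ∑_{i<q} (1+z)^i` and the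
geometric sum is `≡ q` modulo the ball of radius `‖z‖`. [folklore] -/
theorem norm_one_add_pow_sub_one_le_mul {z : K} (hz : ‖z‖ ≤ 1) (q : ℕ) :
    ‖(1 + z) ^ q - 1‖ ≤ ‖z‖ * max ‖(q : K)‖ ‖z‖ := by
  have e : (1 + z) ^ q - 1 = z * ∑ i ∈ Finset.range q, (1 + z) ^ i := by
    have h := geom_sum_mul (1 + z) q
    rw [add_sub_cancel_left] at h
    rw [← h, mul_comm]
  rw [e, norm_mul]
  refine mul_le_mul_of_nonneg_left ?_ (norm_nonneg _)
  have e2 : (∑ i ∈ Finset.range q, (1 + z) ^ i) =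
      ((∑ i ∈ Finset.range q, (1 + z) ^ i) - q) + q := by ring
  rw [e2]
  refine (IsUltrametricDist.norm_add_le_max _ _).trans ?_
  rw [max_comm]
  exact max_le_max le_rfl (norm_geom_sum_sub_natCast_le hz q)

/-- `‖(1+z)^{q^k} − 1‖ ≤ ‖z‖ · max(‖q‖, ‖z‖)^k` for `‖z‖ ≤ 1` (iterate the previous estimate; for
`q = p` in a `p`-adic field the ratio `max(‖p‖, ‖z‖)` is `< 1`). [folklore] -/
theorem norm_one_add_pow_pow_sub_one_le {z : K} (hz : ‖z‖ ≤ 1) (q k : ℕ) :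
    ‖(1 + z) ^ q ^ k - 1‖ ≤ ‖z‖ * (max ‖(q : K)‖ ‖z‖) ^ k := by
  induction k with
  | zero => simp
  | succ k ih =>
    set zk := (1 + z) ^ q ^ k - 1 with hzk
    have hzk1 : ‖zk‖ ≤ ‖z‖ := norm_one_add_pow_sub_one_le hz _
    have e : (1 + z) ^ q ^ (k + 1) - 1 = (1 + zk) ^ q - 1 := by
      rw [hzk, add_sub_cancel, pow_succ, pow_mul]
    rw [e]
    refine (norm_one_add_pow_sub_one_le_mul (hzk1.trans hz) q).trans ?_
    rw [pow_succ, ← mul_assoc]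
    exact mul_le_mul ih (max_le_max le_rfl hzk1) (le_max_of_le_right (norm_nonneg _))
      (mul_nonneg (norm_nonneg _) (pow_nonneg (le_max_of_le_right (norm_nonneg _)) _))

end Ultra

/-! ### Teichmüller convergence on the unit sphere of `ℚ̄_p` -/

section PadicAlgCl

variable {p : ℕ} [Fact p.Prime]

/-- **Some power of a unit is close to `1`.** For `u ∈ ℚ̄_p` with `‖u‖ = 1` there is `M ≥ 1` with
`‖u^M − 1‖ < 1`. Compactness proof avoiding residue fields: `u` is algebraic, so `ℚ_p(u)` is a
finite-dimensional, hence proper, normed `ℚ_p`-space; its closed unit ball is compact and contains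
all powers of `u`; cover it by finitely many open unit balls and pigeonhole two powers `u^a, u^b`
(`a < b`) into one ball: `‖u^a − u^b‖ < 1`, i.e. `‖u^{b-a} − 1‖ < 1`. [folklore] -/
theorem exists_norm_pow_sub_one_lt_one (u : PadicAlgCl p) (hu : ‖u‖ = 1) :
    ∃ M : ℕ, 0 < M ∧ ‖u ^ M - 1‖ < 1 := by
  have hint : IsIntegral ℚ_[p] u := Algebra.IsIntegral.isIntegral u
  set E := IntermediateField.adjoin ℚ_[p] ({u} : Set (PadicAlgCl p)) with hE
  haveI hfd : FiniteDimensional ℚ_[p] E := IntermediateField.adjoin.finiteDimensional hint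
  let W : Submodule ℚ_[p] (PadicAlgCl p) := Subalgebra.toSubmodule E.toSubalgebra
  haveI : FiniteDimensional ℚ_[p] W := hfd
  haveI : ProperSpace W := FiniteDimensional.proper ℚ_[p] W
  have hmem : ∀ n : ℕ, u ^ n ∈ W := fun n =>
    pow_mem (IntermediateField.mem_adjoin_simple_self ℚ_[p] u) n
  have hK : IsCompact (closedBall (0 : W) 1) := isCompact_closedBall 0 1
  obtain ⟨t, hcover⟩ := hK.elim_finite_subcover (fun w : W => ball w 1) (fun _ => isOpen_ball)
    (fun w _ => Set.mem_iUnion.2 ⟨w, mem_ball_self one_pos⟩)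
  let v : ℕ → W := fun n => ⟨u ^ n, hmem n⟩
  have hv : ∀ n, v n ∈ closedBall (0 : W) 1 := fun n => by
    rw [mem_closedBall, dist_zero_right]
    change ‖(u ^ n : PadicAlgCl p)‖ ≤ 1
    rw [norm_pow, hu, one_pow]
  have hsel : ∀ n, ∃ w ∈ t, v n ∈ ball w 1 := fun n => by
    simpa only [Set.mem_iUnion, exists_prop] using hcover (hv n)
  choose w hw hvw using hsel
  obtain ⟨a, b, hab, heq⟩ := Finite.exists_ne_map_eq_of_infinite (fun n : ℕ => (⟨w n, hw n⟩ : t))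
  have hwab : w a = w b := congrArg Subtype.val heq
  have hd : ∀ n, dist (u ^ n) ((w n : W) : PadicAlgCl p) < 1 := fun n => by
    have := hvw n
    rwa [mem_ball, Subtype.dist_eq] at this
  have hdist : dist (u ^ a) (u ^ b) < 1 := by
    calc dist (u ^ a) (u ^ b)
        ≤ max (dist (u ^ a) ((w a : W) : PadicAlgCl p)) (dist ((w a : W) : PadicAlgCl p) (u ^ b)) :=
          IsUltrametricDist.dist_triangle_max _ _ _
      _ < 1 := max_lt (hd a) (by rw [hwab, dist_comm]; exact hd b)
  wlog hlt : a < b generalizing a b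
  · exact this b a hab.symm heq.symm hwab.symm (by rwa [dist_comm])
      (lt_of_le_of_ne (not_lt.1 hlt) hab.symm)
  refine ⟨b - a, Nat.sub_pos_of_lt hlt, ?_⟩
  have hsplit : u ^ b = u ^ a * u ^ (b - a) := by rw [← pow_add, Nat.add_sub_cancel' hlt.le]
  rw [dist_eq_norm, hsplit, ← mul_one_sub, norm_mul, norm_pow, hu, one_pow, one_mul,
    norm_sub_rev] at hdist
  exact hdist

/-- **Teichmüller convergence**: for `u ∈ ℚ̄_p` with `‖u‖ = 1`, `u^{m!} → 1` (`u^M ∈ 1 + 𝔪`,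
`‖(u^M)^{p^k} − 1‖ ≤ max(‖p‖, ‖u^M − 1‖)^k → 0`, and `M p^k ∣ m!` eventually). This is the
"unit branch" left open in `Disproof.lean` §7 S1 — pure `p`-adic analysis. [folklore] -/
theorem tendsto_pow_factorial_nhds_one (u : PadicAlgCl p) (hu : ‖u‖ = 1) :
    Tendsto (fun m : ℕ => u ^ m.factorial) atTop (𝓝 1) := by
  obtain ⟨M, hM, hM1⟩ := exists_norm_pow_sub_one_lt_one u hu
  set z : PadicAlgCl p := u ^ M - 1 with hz
  have hp : ‖(p : PadicAlgCl p)‖ < 1 := by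
    rw [← map_natCast (algebraMap ℚ_[p] (PadicAlgCl p)) p, PadicAlgCl.norm_extends, Padic.norm_p]
    exact inv_lt_one_of_one_lt₀ (by exact_mod_cast (Fact.out : p.Prime).one_lt)
  set ρ : ℝ := max ‖(p : PadicAlgCl p)‖ ‖z‖ with hρ
  have hρ1 : ρ < 1 := max_lt hp hM1
  have hρ0 : 0 ≤ ρ := le_max_of_le_right (norm_nonneg _)
  rw [Metric.tendsto_atTop]
  intro ε hε
  obtain ⟨k, hk⟩ := exists_pow_lt_of_lt_one hε hρ1
  refine ⟨M * p ^ k, fun m hm => ?_⟩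
  have hdvd : M * p ^ k ∣ m.factorial :=
    Nat.dvd_factorial (Nat.mul_pos hM (pow_pos (Fact.out : p.Prime).pos k)) hm
  obtain ⟨r, hr⟩ := hdvd
  have e : u ^ M = 1 + z := by rw [hz]; ring
  have hzk : ‖(1 + z) ^ p ^ k - 1‖ ≤ ρ ^ k := by
    refine (norm_one_add_pow_pow_sub_one_le hM1.le p k).trans ?_
    calc ‖z‖ * ρ ^ k ≤ 1 * ρ ^ k := mul_le_mul_of_nonneg_right hM1.le (pow_nonneg hρ0 k)
      _ = ρ ^ k := one_mul _
  have hzk1 : ‖(1 + z) ^ p ^ k - 1‖ ≤ 1 := hzk.trans (pow_le_one₀ hρ0 hρ1.le)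
  rw [dist_eq_norm, hr, pow_mul, pow_mul, e]
  have e2 : ((1 + z) ^ p ^ k) ^ r - 1 = (1 + ((1 + z) ^ p ^ k - 1)) ^ r - 1 := by ring
  rw [e2]
  exact ((norm_one_add_pow_sub_one_le hzk1 r).trans hzk).trans_lt hk

/-- On the unit sphere and inside the open unit ball the two limits: `‖u‖ = 1 ⇒ u^{m!} → 1`,
`‖u‖ < 1 ⇒ u^{m!} → 0`; so for `‖u‖ ≤ 1` exactly one of them holds, decided by `‖u‖`. [folklore] -/
theorem tendsto_pow_factorial_nhds_one_iff (u : PadicAlgCl p) (hu : ‖u‖ ≤ 1) :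
    Tendsto (fun m : ℕ => u ^ m.factorial) atTop (𝓝 1) ↔ ‖u‖ = 1 := by
  refine ⟨fun h => ?_, tendsto_pow_factorial_nhds_one u⟩
  rcases hu.eq_or_lt with h1 | h1
  · exact h1
  · exact absurd (tendsto_nhds_unique h (tendsto_pow_factorial_nhds_zero_of_norm_lt_one h1))
      one_ne_zero

end PadicAlgCl

/-! ### The slope dichotomy for continuous points of the Hida-tower Hecke algebra -/

section Hecke

variable {F : Type} [Field F] [NumberField F] {p : ℕ} [Fact p.Prime]

/-- **`IsSlopeZeroAt` is a norm condition.** For a continuous `ℚ̄_p`-point `x` of `𝕋^S(𝒰; p)`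
(`GL₂/F`, any tame level) and any place `v`: `IsSlopeZeroAt x v ↔ ‖x(U_{v,1})‖ = 1`
(integrality of `x` + Teichmüller convergence; for `n = 2` the only index is `j = 1`). [folklore] -/
theorem isSlopeZeroAt_iff_norm_eq_one (𝒰 : TameLevel 2 F p) (x : HidaHeckeAlgebraGLn 𝒰 →+* PadicAlgCl p)
    (hx : Continuous x) (v : HeightOneSpectrum (𝓞 F)) :
    𝒰.IsSlopeZeroAt x v ↔ ‖x (𝒰.hidaT v 1)‖ = 1 := by
  constructor
  · intro h
    exact (tendsto_pow_factorial_nhds_one_iff _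
      (norm_apply_le_one_of_continuous_hida 𝒰 x hx _)).1 (h 1 le_rfl one_lt_two)
  · intro h j hj hj2
    obtain rfl : j = 1 := by omega
    exact tendsto_pow_factorial_nhds_one _ h

/-- **The slope dichotomy** (first lemma `SlopeDichotomy` of the crux's lead card, PROVED with no
automorphic input): for every continuous `ℚ̄_p`-point `x` of `𝕋^S(𝒰; p)` and every place `v`,
either `IsSlopeZeroAt x v` or `x(U_{v,1})^{m!} → 0`. [folklore] -/
theorem slopeDichotomy (𝒰 : TameLevel 2 F p) (x : HidaHeckeAlgebraGLn 𝒰 →+* PadicAlgCl p)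
    (hx : Continuous x) (v : HeightOneSpectrum (𝓞 F)) :
    𝒰.IsSlopeZeroAt x v ∨ Tendsto (fun m : ℕ => x (𝒰.hidaT v 1) ^ m.factorial) atTop (𝓝 0) := by
  rcases norm_hidaT_eq_one_or_lt_one 𝒰 x hx v 1 with h | ⟨-, h⟩
  · exact Or.inl ((isSlopeZeroAt_iff_norm_eq_one 𝒰 x hx v).2 h)
  · exact Or.inr h

/-- The two branches are EXCLUSIVE (limits `1 ≠ 0`). [folklore] -/
theorem not_isSlopeZeroAt_of_tendsto_zero (𝒰 : TameLevel 2 F p) (x : HidaHeckeAlgebraGLn 𝒰 →+* PadicAlgCl p)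
    (v : HeightOneSpectrum (𝓞 F))
    (h : Tendsto (fun m : ℕ => x (𝒰.hidaT v 1) ^ m.factorial) atTop (𝓝 0)) : ¬ 𝒰.IsSlopeZeroAt x v :=
  fun hs => one_ne_zero (tendsto_nhds_unique (hs 1 le_rfl one_lt_two) h)

end Hecke

end Summit.Langlands.Langlands.Theorems.ProModularOrdinaryClassical.Negative
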